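import Summits.QuantumFields.BalabanUV.Beta.GAN24.SandwichReadoutSiteDep

/-!
# `BalabanUV.Beta.GAN24.FaceWeightedSandwich` — binder row G-an2-4 ∕ (CONV-C), W-slot CT-W, the «3F-REC» induction (leaf-04 g62), small tools for the unrolling
# step `ThreeFaceUnroll`: **the outer face weights factor out of the sandwich; the two-scale exit-face condition; coset shifts of `ℋ`-columns**

NOT IN PRINT; OUR BOOKKEEPING ([folklore]; G-an2-4 formalisation swarm, leaf prover `b2b-balaban-gan24-formalise-leaf-04`, gen 62).  HONEST FRAMING (cell contract,
verbatim): «discharging `BetaPertH` makes Bałaban's UV stability UNCONDITIONAL — a real constructive-QFT result; it is NOT the continuum limit and NOT the Clay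
problem.»  HONEST DEPENDENCY (verbatim): «continuum YM on T⁴ ⇐ BetaPertH ∧ nine spine estimates (0/9 proved); BetaPertH ⇐ (D1) ∧ (D4) ∧ CAP+tail; G-an2-4
gates asym, D1 and NE2/3/4.»

WHAT ([folklore]; 0 `def`, 0 cited facts, 0 `def … : Prop`, 0 sorry): `colH_block_shift` (`colH G N μ u κ (N•t + v) = colH G N μ (u − t) κ v` for a block-covariant `G`),
`emod_mul_eq_iff` (`u % (L·P) = L·P − 1 ↔ u % L = L − 1 ∧ (u∕L) % P = P − 1` — the exit face of the `L·P`-blocks is the exit face of the `L`-blocks in the last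
`L`-layer of a `P`-block), `decays_ite_mul` ∕ `decays_mul_ite` (indicator weights keep decay), `zsmul_apply_ediv` (`(Lc•x′)_a ∕ Lc = x′_a`), `comp_comp_weights`
(`((w·G) ∘ V ∘ (G·w′))(p,q) = w(p)·w′(q)·(G ∘ V ∘ G)(p,q)`).  Discharges NOTHING; NEVER «G-an2-4 closed» as (CONV-C); NOT D1, NOT BetaPertH, NOT continuum, NOT Clay.
2026-08-22; no existing file touched.
-/

noncomputable section

open Finset
open scoped BigOperators
open Literature.MathematicalPhysics.QuantumFieldTheory
open Literature.MathematicalPhysics.QuantumFieldTheory.Balaban1983to89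
open Literature.MathematicalPhysics.QuantumFieldTheory.Balaban1983to89.Beta
open B12Sec2to5 (l1 l1_nonneg)
open ExpKernelCalculus (Site MKer Decays comp shiftK)
open OneStepResolventKernel (Fib)
open OneStepKernelFamily (colH)

namespace Summit.QuantumFields.BalabanUV.Beta.GAN24.FaceWeightedSandwich

variable {d : ℕ} {Lc : ℕ} [NeZero Lc]

/-! ## §1 Small tools: coset shift of an `ℋ`-column; the two-scale exit-face condition -/

omit [NeZero Lc] in
/-- [folklore] coset shift of an `ℋ`-column of a block-covariant kernel: `colH G N μ u κ (N•t + v) = colH G N μ (u − t) κ v`. -/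
theorem colH_block_shift {N : ℕ} {G : MKer (d + 1) (Fib d)} (hGs : ∀ t : Site (d + 1), shiftK (-((N : ℤ) • t)) G = G)
    (μ κ : Fin (d + 1)) (u t v : Site (d + 1)) :
    colH G N μ u κ ((N : ℤ) • t + v) = colH G N μ (u - t) κ v := by
  have h := congrFun (congrFun (congrFun (congrFun (hGs t) ((N : ℤ) • t + v)) ((N : ℤ) • u)) (Sum.inl κ)) (Sum.inr μ)
  simp only [shiftK] at h
  have e1 : (N : ℤ) • t + v + -((N : ℤ) • t) = v := by abel
  have e2 : (N : ℤ) • u + -((N : ℤ) • t) = (N : ℤ) • (u - t) := by rw [smul_sub]; abel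
  simp only [colH]
  rw [← h, e1, e2]

omit [NeZero Lc] in
/-- [folklore] **THE TWO-SCALE EXIT-FACE CONDITION**: for `0 < L`, `0 < P`, `u % (L·P) = L·P − 1 ↔ (u % L = L − 1 ∧ (u ∕ L) % P = P − 1)` — the exit face of the
`L·P`-blocks is the exit face of the `L`-blocks lying in the last `L`-layer of the `P`-block of `L`-blocks. -/
theorem emod_mul_eq_iff {L P : ℤ} (hL : 0 < L) (hP : 0 < P) (u : ℤ) :
    u % (L * P) = L * P - 1 ↔ (u % L = L - 1 ∧ (u / L) % P = P - 1) := by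
  have hLP : 0 < L * P := mul_pos hL hP
  set r := u % (L * P) with hr
  set q := u / (L * P) with hq
  have hu : r + L * P * q = u := by
    have h := Int.emod_add_ediv_mul u (L * P)
    rw [← hr, ← hq] at h
    linarith [h, mul_comm (L * P) q]
  have hr0 : 0 ≤ r := Int.emod_nonneg u hLP.ne'
  have hr1 : r < L * P := Int.emod_lt_of_pos u hLP
  -- the `L`-digit and the `P`-digit of `u` in terms of `r`
  have h1 : u % L = r % L := by
    rw [← hu, show r + L * P * q = r + L * (P * q) by ring, Int.add_mul_emod_self_left]
  have h2 : u / L = r / L + P * q := by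
    rw [← hu, show r + L * P * q = r + L * (P * q) by ring, Int.add_mul_ediv_left _ _ hL.ne']
  have hrL0 : 0 ≤ r / L := Int.ediv_nonneg hr0 hL.le
  have hrL1 : r / L < P := Int.ediv_lt_of_lt_mul hL (by rw [mul_comm]; exact hr1)
  have h3 : (u / L) % P = r / L := by
    rw [h2, Int.add_mul_emod_self_left, Int.emod_eq_of_lt hrL0 hrL1]
  have hrdec : r % L + L * (r / L) = r := by
    have h := Int.emod_add_ediv_mul r L
    linarith [h, mul_comm L (r / L)]
  have hrem0 : 0 ≤ r % L := Int.emod_nonneg r hL.ne'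
  have hrem1 : r % L < L := Int.emod_lt_of_pos r hL
  rw [h1, h3]
  constructor
  · intro h
    -- `r = L·P − 1`
    have hd : r % L = L - 1 ∧ r / L = P - 1 := by
      have := (Int.ediv_emod_unique hL (a := r) (r := L - 1) (q := P - 1)).2 ⟨by rw [h]; ring, by omega, by omega⟩
      exact ⟨this.2, this.1⟩
    exact hd
  · rintro ⟨ha, hb⟩
    have : r = L * (r / L) + r % L := by rw [add_comm]; exact hrdec.symm
    rw [this, ha, hb]
    ring

/-! ## §2 The face-weighted outer kernels and their coarse-leg charges -/

section Kernels

variable {r : Fin (d + 1) → ℕ}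

omit [NeZero Lc] in
/-- [folklore] an indicator weight does not spoil decay. -/
theorem decays_ite_mul {K : MKer (d + 1) (Fib d)} {C δ : ℝ} (hK : Decays K C δ) (c : Site (d + 1) → Prop) [DecidablePred c] :
    Decays (fun x y a b => (if c x then (1 : ℝ) else 0) * K x y a b) C δ := by
  intro x y a b
  have h := hK x y a b
  have hC : 0 ≤ C * Real.exp (-δ * l1 (x - y)) := (abs_nonneg _).trans h
  show |(if c x then (1 : ℝ) else 0) * K x y a b| ≤ _
  split_ifs
  · rw [one_mul]; exact h
  · rw [zero_mul, abs_zero]; exact hC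

omit [NeZero Lc] in
/-- [folklore] the same on the second index. -/
theorem decays_mul_ite {K : MKer (d + 1) (Fib d)} {C δ : ℝ} (hK : Decays K C δ) (c : Site (d + 1) → Prop) [DecidablePred c] :
    Decays (fun x y a b => K x y a b * (if c y then (1 : ℝ) else 0)) C δ := by
  intro x y a b
  have h := hK x y a b
  have hC : 0 ≤ C * Real.exp (-δ * l1 (x - y)) := (abs_nonneg _).trans h
  show |K x y a b * (if c y then (1 : ℝ) else 0)| ≤ _
  split_ifs
  · rw [mul_one]; exact h
  · rw [mul_zero, abs_zero]; exact hC

/-- [folklore] the block index of a coarse point: `(Lc•x′)_a ∕ Lc = x′_a`. -/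
theorem zsmul_apply_ediv (x' : Site (d + 1)) (a : Fin (d + 1)) : ((Lc : ℤ) • x') a / (Lc : ℤ) = x' a := by
  have hLc : (Lc : ℤ) ≠ 0 := by exact_mod_cast NeZero.ne Lc
  simp only [Pi.smul_apply, smul_eq_mul]
  exact Int.mul_ediv_cancel_left _ hLc

end Kernels


/-! ## §3 The weighted sandwich is the face-weighted cubic sector -/

section Weighted

omit [NeZero Lc] in
/-- [folklore] **OUTER WEIGHTS FACTOR OUT OF THE SANDWICH**: `((w·G) ∘ V ∘ (G·w′))(p, q) = w(p)·w′(q)·(G ∘ V ∘ G)(p, q)`. -/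
theorem comp_comp_weights (G V : MKer (d + 1) (Fib d)) (w w' : Site (d + 1) → ℝ) (p q : Site (d + 1)) (a b : Fib d) :
    comp (comp (fun x y e f => w x * G x y e f) V) (fun x y e f => G x y e f * w' y) p q a b
      = w p * w' q * comp (comp G V) G p q a b := by
  simp only [comp]
  have key : ∀ (t : Site (d + 1)) (g : Fib d),
      (∑' s : Site (d + 1), ∑ f : Fib d, w p * G p s a f * V s t f g) * (G t q g b * w' q)
        = (w p * w' q) * ((∑' s : Site (d + 1), ∑ f : Fib d, G p s a f * V s t f g) * G t q g b) := by
    intro t g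
    have e : (∑' s : Site (d + 1), ∑ f : Fib d, w p * G p s a f * V s t f g) = w p * ∑' s : Site (d + 1), ∑ f : Fib d, G p s a f * V s t f g := by
      rw [← tsum_mul_left]
      refine tsum_congr fun s => ?_
      rw [Finset.mul_sum]
      refine Finset.sum_congr rfl fun f _ => ?_
      ring
    rw [e]
    ring
  calc (∑' t : Site (d + 1), ∑ g : Fib d, (∑' s : Site (d + 1), ∑ f : Fib d, w p * G p s a f * V s t f g) * (G t q g b * w' q))
      = ∑' t : Site (d + 1), ∑ g : Fib d, (w p * w' q) * ((∑' s : Site (d + 1), ∑ f : Fib d, G p s a f * V s t f g) * G t q g b) :=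
        tsum_congr fun t => Finset.sum_congr rfl fun g _ => key t g
    _ = ∑' t : Site (d + 1), (w p * w' q) * ∑ g : Fib d, (∑' s : Site (d + 1), ∑ f : Fib d, G p s a f * V s t f g) * G t q g b :=
        tsum_congr fun t => by rw [Finset.mul_sum]
    _ = (w p * w' q) * ∑' t : Site (d + 1), ∑ g : Fib d, (∑' s : Site (d + 1), ∑ f : Fib d, G p s a f * V s t f g) * G t q g b :=
        tsum_mul_left

end Weighted


end Summit.QuantumFields.BalabanUV.Beta.GAN24.FaceWeightedSandwich

end
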